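import Mathlib
import Summits.ValiantsHypothesis.ValiantsHypothesis.Theorems.LacunarySymmetroidMatrixDescartesCensusDefs
import Summits.ValiantsHypothesis.ValiantsHypothesis.Theorems.LacunarySymmetroidMatrixDescartesStubDescartesCeiling

/-!
# Tower graft line — DESCARTES IS SIGN-SATURATED AT `m = 2` ON EVERY TOWER: for every `K` and every 2-tower `d` an explicit integer
# symmetric `2 × 2` pencil whose determinant has all `C(K+1,2)` pair-sum coefficients non-zero and PERFECTLY ALTERNATING in sign

Calibration file for LINE (B) `Cruxes/WeakLifting/Lines/tower_graft.lean` of the crux `WeakLifting` (stmt-ValiantsHypothesis-19561), `m = 2`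
rung of S5 (`…TowerGraftRowTwoRung`: the rung is the growth order of the tower row `K ↦ sup_{2-towers} ζ₊(2; d)`).  NO stub is claimed.

On a 2-tower (`2·dₗ < d_{l'}` for `l < l'`) the pair sums `dᵢ + dⱼ` (`i ≤ j`) are pairwise distinct and increase with the LEX rank
`j(j+1)/2 + i` (`pairSum_lt_of_rank`), so the determinant of a `2 × 2` pencil `∑ₗ X^{dₗ} Sₗ` has exactly the `C(K+1,2)` possible monomials
`X^{dᵢ+dⱼ}` with coefficients the MIXED DISCRIMINANTS `aᵢcⱼ + aⱼcᵢ − 2bᵢbⱼ` (`i < j`) and `aᵢcᵢ − bᵢ²` (`coeff_det_pencil_two_pairSum`).  The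
tree's `m = 2` tower ceilings for SEMIDEFINITE-letter words (`TowerRowTwoCap.card_posRoots_le_two_mul`: `Z₊ ≤ 2K`, Descartes with clustered
negative coefficients) rest on the sign pattern of these coefficients.  For GENERAL symmetric letters no sign argument survives:

* ★ `signSaturated_letters` / `coeff_det_signSaturated` — the integer letters `Sⱼ = [[2(−1)ʲ, (−1)ʲ2ʲ], [(−1)ʲ2ʲ, (−1)^{j(j+1)/2}4ʲ]]`
  give, on EVERY support with distinct pair sums (every 2-tower, `coeff_det_signSaturated_tower`), `sign coeff_{dᵢ+dⱼ}(det) = (−1)^{j(j+1)/2 + i}`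
  for all `i ≤ j` — the coefficient sequence read by increasing exponent alternates at EVERY one of its `C(K+1,2) − 1` steps, i.e. Descartes'
  bound `C(K+1,2) − 1` for `ζ₊(2; d)` is SIGN-SATURATED on every tower, uniformly in `K`.  (Mechanism: `det` on `Sym₂(ℝ)` is a Lorentz form;
  the letters are `(−1)ʲ ×` vectors hugging the light cone with a period-4 timelike/spacelike pattern.)

So any proof of a linear (or any sub-Descartes) tower cap at `m = 2` — the live side of the `m = 2` rung — must use coefficient MAGNITUDES
(fewnomial / Wronskian / valuation arguments), not sign patterns; consistent with the located status of the `fg + 1` question (no bound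
better than Descartes known, Jindal–Pandey–Shukla–Zisopoulos 2020 §1.2).  The letters here are NOT claimed to have many real zeros (their
blocks have flat magnitudes; the tree's tropical ceilings `4K − 7` / `3K − 4` bound what patchworking can certify).
HONEST FRAMING: an explicit sign computation; nothing on S4/S4b/S5/S5ᴸ, TowerB, `WeakLifting`, Conjecture B, `MatrixDescartes` (18050) or
`VP ≠ VNP`.  Def-free.  Seat: prover leafhand-val-kpluslogsqlaw-1 g3, `--supports stmt-ValiantsHypothesis-19561`.

[folklore] Descartes' rule of signs; Leibniz expansion of a `2 × 2` pencil determinant.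
-/

-- `Summit.ValiantsHypothesis.ValiantsHypothesis.…` repeats a component by the D-0017 layout
-- (single-conjunct summit), which the `dupNamespace` linter flags; the name is mandated.
set_option linter.dupNamespace false
set_option autoImplicit false

namespace Summit.ValiantsHypothesis.ValiantsHypothesis.Theorems.KPlusLogSqLaw.TowerGraft

open Polynomial Finset Matrix
open scoped BigOperators Polynomial
open Summit.ValiantsHypothesis.ValiantsHypothesis.Theorems.LacunarySymmetroidMatrixDescartes (PosRootLawOn)
open Summit.ValiantsHypothesis.ValiantsHypothesis.Theorems.LacunarySymmetroidMatrixDescartes.StubDescartesCeiling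
  (pencil_apply coeff_det_pencil_eq_zero)

namespace RowTwoSigns

variable {K : ℕ}

/-! ## 1. Coefficients of a `2 × 2` pencil determinant -/

/-- coefficient of a product of two fewnomials on the same support. [folklore] -/
theorem coeff_fewnomial_mul (d : Fin K → ℕ) (a b : Fin K → ℝ) (n : ℕ) :
    ((∑ l, (X : ℝ[X]) ^ d l * C (a l)) * (∑ l, (X : ℝ[X]) ^ d l * C (b l))).coeff n =
      ∑ l, ∑ k, if n = d l + d k then a l * b k else 0 := by
  rw [Finset.sum_mul_sum, finsetSum_coeff]
  refine Finset.sum_congr rfl fun l _ => ?_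
  rw [finsetSum_coeff]
  refine Finset.sum_congr rfl fun k _ => ?_
  rw [show (X : ℝ[X]) ^ d l * C (a l) * (X ^ d k * C (b k)) = C (a l * b k) * X ^ (d l + d k) by
    rw [C_mul, pow_add]; ring]
  rw [coeff_C_mul_X_pow]

/-- **Coefficients of `det ∑ₗ X^{dₗ} Sₗ` for `2 × 2` letters**: the coefficient at `n` is the sum of `Sₗ₀₀ Sₖ₁₁ − Sₗ₀₁ Sₖ₁₀` over the
ordered pairs `(l, k)` with `dₗ + dₖ = n`. [folklore] -/
theorem coeff_det_pencil_two (d : Fin K → ℕ) (S : Fin K → Matrix (Fin 2) (Fin 2) ℝ) (n : ℕ) :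
    ((∑ l, (X : ℝ[X]) ^ d l • (S l).map C).det).coeff n =
      ∑ l, ∑ k, if n = d l + d k then (S l 0 0 * S k 1 1 - S l 0 1 * S k 1 0) else 0 := by
  rw [Matrix.det_fin_two, pencil_apply, pencil_apply, pencil_apply, pencil_apply, coeff_sub,
    coeff_fewnomial_mul, coeff_fewnomial_mul, ← Finset.sum_sub_distrib]
  refine Finset.sum_congr rfl fun l _ => ?_
  rw [← Finset.sum_sub_distrib]
  refine Finset.sum_congr rfl fun k _ => ?_
  split_ifs <;> ring

/-- the mixed discriminant of an ordered pair of `2 × 2` letters: `F(l,k) = Sₗ₀₀ Sₖ₁₁ − Sₗ₀₁ Sₖ₁₀`. -/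
theorem sum_pair_filter_eq {d : Fin K → ℕ}
    (hpair : ∀ l k l' k' : Fin K, d l + d k = d l' + d k' → (l = l' ∧ k = k') ∨ (l = k' ∧ k = l'))
    (F : Fin K → Fin K → ℝ) (i j : Fin K) :
    (∑ l, ∑ k, if d i + d j = d l + d k then F l k else 0) = if i = j then F i i else F i j + F j i := by
  classical
  rw [← Finset.sum_product' (f := fun l k => if d i + d j = d l + d k then F l k else 0), ← Finset.sum_filter]
  have hset : (Finset.univ ×ˢ Finset.univ : Finset (Fin K × Fin K)).filter (fun p => d i + d j = d p.1 + d p.2) =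
      insert (i, j) {(j, i)} := by
    ext p
    simp only [Finset.mem_filter, Finset.mem_product, Finset.mem_univ, true_and, Finset.mem_insert, Finset.mem_singleton]
    constructor
    · intro h
      rcases hpair i j p.1 p.2 h with ⟨h1, h2⟩ | ⟨h1, h2⟩
      · left; exact Prod.ext h1.symm h2.symm
      · right; exact Prod.ext h2.symm h1.symm
    · rintro (rfl | rfl)
      · rfl
      · simp only; ring
  rw [hset]
  by_cases hij : i = j
  · subst hij
    rw [if_pos rfl, Finset.insert_eq_of_mem (Finset.mem_singleton_self _), Finset.sum_singleton]
  · rw [if_neg hij, Finset.sum_insert (by simp only [Finset.mem_singleton, Prod.mk.injEq, not_and]; exact fun h _ => hij h),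
      Finset.sum_singleton]

/-- **On a support with distinct pair sums** the coefficient of `det ∑ₗ X^{dₗ} Sₗ` at `dᵢ + dⱼ` is the mixed discriminant:
`Sᵢ₀₀Sᵢ₁₁ − Sᵢ₀₁Sᵢ₁₀` for `i = j`, and `Sᵢ₀₀Sⱼ₁₁ + Sⱼ₀₀Sᵢ₁₁ − Sᵢ₀₁Sⱼ₁₀ − Sⱼ₀₁Sᵢ₁₀` for `i ≠ j`. [folklore] -/
theorem coeff_det_pencil_two_pairSum {d : Fin K → ℕ}
    (hpair : ∀ l k l' k' : Fin K, d l + d k = d l' + d k' → (l = l' ∧ k = k') ∨ (l = k' ∧ k = l'))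
    (S : Fin K → Matrix (Fin 2) (Fin 2) ℝ) (i j : Fin K) :
    ((∑ l, (X : ℝ[X]) ^ d l • (S l).map C).det).coeff (d i + d j) =
      if i = j then S i 0 0 * S i 1 1 - S i 0 1 * S i 1 0
      else (S i 0 0 * S j 1 1 - S i 0 1 * S j 1 0) + (S j 0 0 * S i 1 1 - S j 0 1 * S i 1 0) := by
  rw [coeff_det_pencil_two]
  exact sum_pair_filter_eq hpair (fun l k => S l 0 0 * S k 1 1 - S l 0 1 * S k 1 0) i j

/-- Off the pair sums every coefficient of a `2 × 2` pencil determinant vanishes. [folklore] -/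
theorem coeff_det_pencil_two_eq_zero (d : Fin K → ℕ) (S : Fin K → Matrix (Fin 2) (Fin 2) ℝ) (n : ℕ)
    (hn : ∀ i j : Fin K, n ≠ d i + d j) :
    ((∑ l, (X : ℝ[X]) ^ d l • (S l).map C).det).coeff n = 0 := by
  refine coeff_det_pencil_eq_zero d S fun f hf => hn (f 0) (f 1) ?_
  rw [Fin.sum_univ_two] at hf
  exact hf.symm

/-! ## 2. Towers: distinct pair sums in lex order -/

/-- on a 2-tower the support is strictly increasing. [folklore] -/
theorem strictMono_of_tower {d : Fin K → ℕ} (hd : ∀ l l' : Fin K, l < l' → 2 * d l < d l') : StrictMono d :=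
  fun l l' h => by have := hd l l' h; omega

/-- **LEX ORDER OF PAIR SUMS ON A 2-TOWER**: for `i ≤ j` and `i' ≤ j'`, `(j, i) <_lex (j', i')` forces `dᵢ + dⱼ < dᵢ' + dⱼ'`. [folklore] -/
theorem pairSum_lt_of_lex {d : Fin K → ℕ} (hd : ∀ l l' : Fin K, l < l' → 2 * d l < d l')
    {i j i' j' : Fin K} (hij : i ≤ j) (_hij' : i' ≤ j') (h : j < j' ∨ (j = j' ∧ i < i')) :
    d i + d j < d i' + d j' := by
  have hmono := strictMono_of_tower hd
  rcases h with h | ⟨rfl, h⟩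
  · have h1 : d i ≤ d j := hmono.monotone hij
    have h2 := hd j j' h
    omega
  · have := hmono h
    omega

/-- sorted uniqueness of pair sums on a 2-tower. [folklore] -/
theorem pairSum_inj_sorted {d : Fin K → ℕ} (hd : ∀ l l' : Fin K, l < l' → 2 * d l < d l')
    {i j i' j' : Fin K} (hij : i ≤ j) (hij' : i' ≤ j') (h : d i + d j = d i' + d j') : i = i' ∧ j = j' := by
  rcases lt_trichotomy j j' with hj | rfl | hj
  · exact absurd h (ne_of_lt (pairSum_lt_of_lex hd hij hij' (Or.inl hj)))
  · rcases lt_trichotomy i i' with hi | rfl | hi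
    · exact absurd h (ne_of_lt (pairSum_lt_of_lex hd hij hij' (Or.inr ⟨rfl, hi⟩)))
    · exact ⟨rfl, rfl⟩
    · exact absurd h.symm (ne_of_lt (pairSum_lt_of_lex hd hij' hij (Or.inr ⟨rfl, hi⟩)))
  · exact absurd h.symm (ne_of_lt (pairSum_lt_of_lex hd hij' hij (Or.inl hj)))

/-- **DISTINCT PAIR SUMS ON A 2-TOWER** (unordered pairs): `dₗ + dₖ = dₗ' + dₖ'` forces `{l, k} = {l', k'}`. [folklore] -/
theorem pairSum_unique_of_tower {d : Fin K → ℕ} (hd : ∀ l l' : Fin K, l < l' → 2 * d l < d l') :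
    ∀ l k l' k' : Fin K, d l + d k = d l' + d k' → (l = l' ∧ k = k') ∨ (l = k' ∧ k = l') := by
  intro l k l' k' h
  rcases le_total l k with hlk | hlk <;> rcases le_total l' k' with hlk' | hlk'
  · exact Or.inl (pairSum_inj_sorted hd hlk hlk' h)
  · have := pairSum_inj_sorted hd hlk hlk' (by rw [h, add_comm])
    exact Or.inr ⟨this.1, this.2⟩
  · have := pairSum_inj_sorted hd hlk hlk' (by rw [← h, add_comm])
    exact Or.inr ⟨this.2.symm ▸ rfl, this.1.symm ▸ rfl⟩
  · have := pairSum_inj_sorted hd hlk hlk' (by rw [add_comm, h, add_comm])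
    exact Or.inl ⟨this.2, this.1⟩

/-! ## 3. The sign-saturated letters -/

/-- the letters `Sⱼ = [[2(−1)ʲ, (−1)ʲ2ʲ], [(−1)ʲ2ʲ, (−1)^{j(j+1)/2}4ʲ]]` (integer entries; symmetric). -/
theorem signSaturated_isSymm (j : ℕ) :
    (!![2 * (-1 : ℝ) ^ j, (-1 : ℝ) ^ j * 2 ^ j; (-1 : ℝ) ^ j * 2 ^ j, (-1 : ℝ) ^ (j * (j + 1) / 2) * 4 ^ j] :
      Matrix (Fin 2) (Fin 2) ℝ).IsSymm := by
  rw [Matrix.IsSymm]; ext a b; fin_cases a <;> fin_cases b <;> rfl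

/-- `−x ≤ (−1)ⁿ·x` for `x ≥ 0`. -/
theorem neg_le_neg_one_pow_mul (n : ℕ) {x : ℝ} (hx : 0 ≤ x) : -x ≤ (-1 : ℝ) ^ n * x := by
  rcases neg_one_pow_eq_or ℝ n with h | h <;> rw [h] <;> linarith

/-- `(−1)ⁿ·x ≤ x` for `x ≥ 0`. -/
theorem neg_one_pow_mul_le (n : ℕ) {x : ℝ} (hx : 0 ≤ x) : (-1 : ℝ) ^ n * x ≤ x := by
  rcases neg_one_pow_eq_or ℝ n with h | h <;> rw [h] <;> linarith

/-- the diagonal sign: `(−1)^{T_j + j} · (aⱼcⱼ − bⱼ²) = 2·4ʲ − (−1)^{T_j+j}·4ʲ ≥ 4ʲ > 0` (`T_j = j(j+1)/2`). -/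
theorem diag_sign (j : ℕ) :
    0 < (-1 : ℝ) ^ (j * (j + 1) / 2 + j) *
      (2 * (-1 : ℝ) ^ j * ((-1 : ℝ) ^ (j * (j + 1) / 2) * 4 ^ j) - (-1 : ℝ) ^ j * 2 ^ j * ((-1 : ℝ) ^ j * 2 ^ j)) := by
  have h4 : (0 : ℝ) < 4 ^ j := by positivity
  have hsq : (2 : ℝ) ^ j * 2 ^ j = 4 ^ j := by rw [← mul_pow]; norm_num
  have e1 : (-1 : ℝ) ^ (j * (j + 1) / 2 + j) * (2 * (-1 : ℝ) ^ j * ((-1 : ℝ) ^ (j * (j + 1) / 2) * 4 ^ j)) = 2 * 4 ^ j := by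
    have : (-1 : ℝ) ^ (j * (j + 1) / 2 + j) * ((-1 : ℝ) ^ j * (-1 : ℝ) ^ (j * (j + 1) / 2)) = 1 := by
      rw [← pow_add, ← pow_add, show j * (j + 1) / 2 + j + (j + j * (j + 1) / 2) = 2 * (j * (j + 1) / 2 + j) by ring, pow_mul]
      norm_num
    calc _ = 2 * 4 ^ j * ((-1 : ℝ) ^ (j * (j + 1) / 2 + j) * ((-1 : ℝ) ^ j * (-1 : ℝ) ^ (j * (j + 1) / 2))) := by ring
      _ = 2 * 4 ^ j := by rw [this, mul_one]
  have e2 : (-1 : ℝ) ^ (j * (j + 1) / 2 + j) * ((-1 : ℝ) ^ j * 2 ^ j * ((-1 : ℝ) ^ j * 2 ^ j)) =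
      (-1 : ℝ) ^ (j * (j + 1) / 2 + j) * 4 ^ j := by
    have hjj : (-1 : ℝ) ^ j * (-1) ^ j = 1 := by rw [← pow_add, ← two_mul, pow_mul]; norm_num
    rw [show (-1 : ℝ) ^ j * 2 ^ j * ((-1 : ℝ) ^ j * 2 ^ j) = ((-1 : ℝ) ^ j * (-1) ^ j) * (2 ^ j * 2 ^ j) by ring,
      hjj, one_mul, hsq]
  rw [mul_sub, e1, e2]
  have := neg_one_pow_mul_le (j * (j + 1) / 2 + j) h4.le
  linarith

/-- the key magnitude inequality: `4ⁱ + 2^{i+j} < 4ʲ` for `i < j`. -/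
theorem four_pow_dominates {i j : ℕ} (hij : i < j) : (4 : ℝ) ^ i + 2 ^ (i + j) < 4 ^ j := by
  obtain ⟨r, rfl⟩ : ∃ r, j = i + 1 + r := ⟨j - i - 1, by omega⟩
  have h4i : (0 : ℝ) < 4 ^ i := by positivity
  have h2r : (1 : ℝ) ≤ 2 ^ r := one_le_pow₀ (by norm_num)
  have h42 : (2 : ℝ) ^ r ≤ 4 ^ r := pow_le_pow_left₀ (by norm_num) (by norm_num) r
  have e1 : (4 : ℝ) ^ (i + 1 + r) = 4 ^ i * 4 * 4 ^ r := by rw [pow_add, pow_succ]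
  have e2 : (2 : ℝ) ^ (i + (i + 1 + r)) = 4 ^ i * 2 * 2 ^ r := by
    rw [show i + (i + 1 + r) = 2 * i + 1 + r by ring, pow_add, pow_succ, pow_mul]; norm_num
  rw [e1, e2]
  nlinarith [mul_pos h4i (by norm_num : (0:ℝ) < 1)]

/-- the mixed sign: for `i < j`, `(−1)^{T_j + i} · (aᵢcⱼ + aⱼcᵢ − 2bᵢbⱼ) ≥ 2·4ʲ − 2·4ⁱ − 2·2^{i+j} > 0`. -/
theorem mixed_sign {i j : ℕ} (hij : i < j) :
    0 < (-1 : ℝ) ^ (j * (j + 1) / 2 + i) *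
      ((2 * (-1 : ℝ) ^ i * ((-1 : ℝ) ^ (j * (j + 1) / 2) * 4 ^ j) - (-1 : ℝ) ^ i * 2 ^ i * ((-1 : ℝ) ^ j * 2 ^ j)) +
       (2 * (-1 : ℝ) ^ j * ((-1 : ℝ) ^ (i * (i + 1) / 2) * 4 ^ i) - (-1 : ℝ) ^ j * 2 ^ j * ((-1 : ℝ) ^ i * 2 ^ i))) := by
  have h4i : (0 : ℝ) ≤ 4 ^ i := by positivity
  have h2 : (0 : ℝ) ≤ 2 ^ (i + j) := by positivity
  have hdom := four_pow_dominates hij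
  -- the leading term is exactly `2·4ʲ`
  have e1 : (-1 : ℝ) ^ (j * (j + 1) / 2 + i) * (2 * (-1 : ℝ) ^ i * ((-1 : ℝ) ^ (j * (j + 1) / 2) * 4 ^ j)) = 2 * 4 ^ j := by
    have : (-1 : ℝ) ^ (j * (j + 1) / 2 + i) * ((-1 : ℝ) ^ i * (-1 : ℝ) ^ (j * (j + 1) / 2)) = 1 := by
      rw [← pow_add, ← pow_add, show j * (j + 1) / 2 + i + (i + j * (j + 1) / 2) = 2 * (j * (j + 1) / 2 + i) by ring, pow_mul]
      norm_num
    calc _ = 2 * 4 ^ j * ((-1 : ℝ) ^ (j * (j + 1) / 2 + i) * ((-1 : ℝ) ^ i * (-1 : ℝ) ^ (j * (j + 1) / 2))) := by ring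
      _ = 2 * 4 ^ j := by rw [this, mul_one]
  -- the two cross terms `bᵢbⱼ`, each `(sign)·2^{i+j}`
  have e2 : (-1 : ℝ) ^ i * 2 ^ i * ((-1 : ℝ) ^ j * 2 ^ j) = (-1 : ℝ) ^ (i + j) * 2 ^ (i + j) := by
    rw [pow_add, pow_add]; ring
  have e2' : (-1 : ℝ) ^ j * 2 ^ j * ((-1 : ℝ) ^ i * 2 ^ i) = (-1 : ℝ) ^ (i + j) * 2 ^ (i + j) := by
    rw [pow_add, pow_add]; ring
  -- the lower term `2·(sign)·4ⁱ`
  set s := (-1 : ℝ) ^ (j * (j + 1) / 2 + i) with hs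
  have hcross : -(2 ^ (i + j) : ℝ) ≤ -(s * ((-1 : ℝ) ^ (i + j) * 2 ^ (i + j))) := by
    have : s * ((-1 : ℝ) ^ (i + j) * 2 ^ (i + j)) = (-1 : ℝ) ^ (j * (j + 1) / 2 + i + (i + j)) * 2 ^ (i + j) := by
      rw [hs, pow_add (-1 : ℝ) (j * (j + 1) / 2 + i)]; ring
    rw [this]
    have := neg_one_pow_mul_le (j * (j + 1) / 2 + i + (i + j)) h2
    linarith
  have hlow : -(2 * 4 ^ i : ℝ) ≤ s * (2 * (-1 : ℝ) ^ j * ((-1 : ℝ) ^ (i * (i + 1) / 2) * 4 ^ i)) := by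
    have : s * (2 * (-1 : ℝ) ^ j * ((-1 : ℝ) ^ (i * (i + 1) / 2) * 4 ^ i)) =
        (-1 : ℝ) ^ (j * (j + 1) / 2 + i + j + i * (i + 1) / 2) * (2 * 4 ^ i) := by
      rw [hs, pow_add (-1 : ℝ) (j * (j + 1) / 2 + i + j), pow_add (-1 : ℝ) (j * (j + 1) / 2 + i)]; ring
    rw [this]
    exact neg_le_neg_one_pow_mul _ (by positivity)
  have expand : s * ((2 * (-1 : ℝ) ^ i * ((-1 : ℝ) ^ (j * (j + 1) / 2) * 4 ^ j) - (-1 : ℝ) ^ i * 2 ^ i * ((-1 : ℝ) ^ j * 2 ^ j)) +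
       (2 * (-1 : ℝ) ^ j * ((-1 : ℝ) ^ (i * (i + 1) / 2) * 4 ^ i) - (-1 : ℝ) ^ j * 2 ^ j * ((-1 : ℝ) ^ i * 2 ^ i))) =
      s * (2 * (-1 : ℝ) ^ i * ((-1 : ℝ) ^ (j * (j + 1) / 2) * 4 ^ j)) - s * ((-1 : ℝ) ^ i * 2 ^ i * ((-1 : ℝ) ^ j * 2 ^ j))
        + s * (2 * (-1 : ℝ) ^ j * ((-1 : ℝ) ^ (i * (i + 1) / 2) * 4 ^ i)) - s * ((-1 : ℝ) ^ j * 2 ^ j * ((-1 : ℝ) ^ i * 2 ^ i)) := by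
    ring
  rw [expand, e1, e2, e2']
  linarith

/-- ★ **SIGN SATURATION ON EVERY SUPPORT WITH DISTINCT PAIR SUMS.**  For the letters
`Sⱼ = [[2(−1)ʲ, (−1)ʲ2ʲ], [(−1)ʲ2ʲ, (−1)^{j(j+1)/2}4ʲ]]` and every `i ≤ j`, the coefficient of `det ∑ₗ X^{dₗ} Sₗ` at `dᵢ + dⱼ` is
non-zero with sign `(−1)^{j(j+1)/2 + i}` — the parity of the LEX RANK of the pair `(j, i)`. [this work] -/
theorem coeff_det_signSaturated {d : Fin K → ℕ}
    (hpair : ∀ l k l' k' : Fin K, d l + d k = d l' + d k' → (l = l' ∧ k = k') ∨ (l = k' ∧ k = l'))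
    (i j : Fin K) (hij : i ≤ j) :
    0 < (-1 : ℝ) ^ ((j : ℕ) * ((j : ℕ) + 1) / 2 + (i : ℕ)) *
      ((∑ l, (X : ℝ[X]) ^ d l •
        ((!![2 * (-1 : ℝ) ^ (l : ℕ), (-1 : ℝ) ^ (l : ℕ) * 2 ^ (l : ℕ);
            (-1 : ℝ) ^ (l : ℕ) * 2 ^ (l : ℕ), (-1 : ℝ) ^ ((l : ℕ) * ((l : ℕ) + 1) / 2) * 4 ^ (l : ℕ)] :
          Matrix (Fin 2) (Fin 2) ℝ).map C)).det).coeff (d i + d j) := by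
  rw [coeff_det_pencil_two_pairSum hpair]
  simp only [Matrix.of_apply, Matrix.cons_val', Matrix.cons_val_zero, Matrix.cons_val_one, Matrix.empty_val',
    Matrix.cons_val_fin_one]
  by_cases h : i = j
  · subst h
    rw [if_pos rfl]
    exact diag_sign i
  · rw [if_neg h]
    have hlt : (i : ℕ) < (j : ℕ) := lt_of_le_of_ne hij (fun e => h (Fin.ext e))
    exact mixed_sign hlt

/-- ★ **DESCARTES IS SIGN-SATURATED AT `m = 2` ON EVERY 2-TOWER, FOR EVERY `K`.**  On a 2-tower `d` with `K` letters there is a real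
symmetric (integer) `2 × 2` pencil on `d` whose determinant has: a non-zero coefficient at each of the `C(K+1,2)` pair sums `dᵢ + dⱼ`
(`i ≤ j`) with sign `(−1)^{rank}`, `rank = j(j+1)/2 + i` the position of `dᵢ + dⱼ` in increasing order (`pairSum_lt_of_lex`), and zero
coefficients elsewhere — so the coefficient sequence alternates at every step and Descartes' rule allows the full `C(K+1,2) − 1`
positive zeros: no sign-pattern argument bounds the tower row `ζ₊(2; d)` below Descartes. [this work] -/
theorem coeff_det_signSaturated_tower {d : Fin K → ℕ} (hd : ∀ l l' : Fin K, l < l' → 2 * d l < d l') :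
    ∃ S : Fin K → Matrix (Fin 2) (Fin 2) ℝ, (∀ l, (S l).IsSymm) ∧
      (∀ i j : Fin K, i ≤ j → 0 < (-1 : ℝ) ^ ((j : ℕ) * ((j : ℕ) + 1) / 2 + (i : ℕ)) *
        ((∑ l, (X : ℝ[X]) ^ d l • (S l).map C).det).coeff (d i + d j)) ∧
      (∀ n : ℕ, (∀ i j : Fin K, n ≠ d i + d j) → ((∑ l, (X : ℝ[X]) ^ d l • (S l).map C).det).coeff n = 0) ∧
      (∀ i j i' j' : Fin K, i ≤ j → i' ≤ j' → (j < j' ∨ (j = j' ∧ i < i')) → d i + d j < d i' + d j') :=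
  ⟨fun l => !![2 * (-1 : ℝ) ^ (l : ℕ), (-1 : ℝ) ^ (l : ℕ) * 2 ^ (l : ℕ);
      (-1 : ℝ) ^ (l : ℕ) * 2 ^ (l : ℕ), (-1 : ℝ) ^ ((l : ℕ) * ((l : ℕ) + 1) / 2) * 4 ^ (l : ℕ)],
    fun l => signSaturated_isSymm l,
    fun i j hij => coeff_det_signSaturated (pairSum_unique_of_tower hd) i j hij,
    fun n hn => coeff_det_pencil_two_eq_zero d _ n hn,
    fun _ _ _ _ hij hij' h => pairSum_lt_of_lex hd hij hij' h⟩

end RowTwoSigns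

end Summit.ValiantsHypothesis.ValiantsHypothesis.Theorems.KPlusLogSqLaw.TowerGraft
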